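import Summits.AtomisticToContinuum.BoseEinsteinCondensation.Theses.BECDispersionLadder
import Literature.Barriers.AtomisticToContinuum.BogoliubovPerturbationInfrared

/-!
# Route BECDispersionLadder, support item `DialPowerCounting` (stmt-AtomisticToContinuum-14560)

Closes `…Theses.BECDispersionLadder.DialPowerCounting`: for every `α > 0`, the one-loop bubble of
two "dial" propagators `1/(k₀² + |𝐤|^α)`, i.e. `((k₀² + (|𝐤|²)^{α/2})⁻¹)²`, is integrable on the
unit infrared ball of `ℝ^{1+3}` (`FreqMomentum 3`, `spatialSq`) iff `α < 2`.

Proof (power counting, [DupuisRancon2011, §2.2] with the kinetic exponent as a dial):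
* `α ≥ 2`: on the unit ball `|𝐤|² ≤ 1`, so `(|𝐤|²)^{α/2} ≤ |𝐤|²` and the integrand dominates the
  phonon bubble `‖k‖⁻⁴ = bubbleIntegrand 1`, which is not integrable in `d = 3`
  (`BoseGas.not_integrableOn_bubbleIntegrand`, the catalogued logarithm).
* `α < 2`: split `ℝ^{1+3} ≃ᵐ ℝ × ℝ³` (volume preserving), enlarge the ball to `ℝ × B³(0,1)` and
  use Tonelli: with `m = |𝐤|^{α/2}`, `∫_ℝ dk₀ (k₀² + m²)⁻² ≤ m⁻² ∫_ℝ dk₀ (k₀² + m²)⁻¹ = π m⁻³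
  = π |𝐤|^{-3α/2}`, and `|𝐤|^{-3α/2}` is integrable on the unit ball of `ℝ³` since `3α/2 < 3`
  (Mathlib `integrableOn_ball_of_norm_le_rpow`).

## References

* [DupuisRancon2011] N. Dupuis, A. Rançon, *Infrared behavior of interacting bosons at zero
  temperature*, arXiv:1106.4921, §2.2 (power counting of the one-loop bubble).
* Barrier file `Literature.Barriers.AtomisticToContinuum.BogoliubovPerturbationInfrared`
  (`not_integrableOn_bubbleIntegrand`, the `α = 2`, `d = 3` endpoint).
-/

noncomputable section

open MeasureTheory Metric Set Filter Real
open scoped BigOperators ENNReal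

namespace Summit.AtomisticToContinuum.BoseEinsteinCondensation.Theorems

namespace DialPowerCounting

open Literature.Barriers.AtomisticToContinuum.BoseGas

/-! ## §1 One-dimensional frequency integrals -/

/-- Rescaling identity `(t² + m²)⁻¹ = m⁻² (1 + (t/m)²)⁻¹` (`m ≠ 0`). [folklore] -/
theorem inv_sq_add_sq_eq {m : ℝ} (hm : m ≠ 0) (t : ℝ) :
    (t ^ 2 + m ^ 2)⁻¹ = (m ^ 2)⁻¹ * (1 + (m⁻¹ * t) ^ 2)⁻¹ := by
  rw [← mul_inv]
  congr 1
  field_simp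
  ring

/-- `t ↦ (t² + m²)⁻¹` is integrable on `ℝ` for `m ≠ 0`. [folklore] -/
theorem integrable_inv_sq_add_sq {m : ℝ} (hm : m ≠ 0) :
    Integrable fun t : ℝ => (t ^ 2 + m ^ 2)⁻¹ := by
  have h : (fun t : ℝ => (t ^ 2 + m ^ 2)⁻¹) =
      fun t => (m ^ 2)⁻¹ * (1 + (m⁻¹ * t) ^ 2)⁻¹ := funext (inv_sq_add_sq_eq hm)
  rw [h]
  exact (integrable_inv_one_add_sq.comp_mul_left' (inv_ne_zero hm)).const_mul _

/-- `∫_ℝ (t² + m²)⁻¹ dt = π / m` for `m > 0`. [folklore] -/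
theorem integral_inv_sq_add_sq {m : ℝ} (hm : 0 < m) :
    ∫ t : ℝ, (t ^ 2 + m ^ 2)⁻¹ = π / m := by
  have h1 : ∫ t : ℝ, (1 + (m⁻¹ * t) ^ 2)⁻¹ = m * π := by
    have := Measure.integral_comp_mul_left (fun t : ℝ => (1 + t ^ 2)⁻¹) m⁻¹
    simpa [abs_of_pos hm] using this
  simp_rw [inv_sq_add_sq_eq hm.ne']
  rw [integral_const_mul, h1]
  field_simp

/-- The frequency integral of the squared dial propagator: for `m > 0`,
`∫_ℝ ‖((t² + m²)⁻¹)²‖ₑ dt ≤ π / m³` (from `(t² + m²)⁻² ≤ m⁻²(t² + m²)⁻¹`; the exact value is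
`π/(2m³)`). [folklore] -/
theorem lintegral_inv_sq_add_sq_sq_le {m : ℝ} (hm : 0 < m) :
    ∫⁻ t : ℝ, ‖(t ^ 2 + m ^ 2)⁻¹ ^ 2‖ₑ ≤ ENNReal.ofReal (π / m ^ 3) := by
  have hm2 : 0 < m ^ 2 := by positivity
  have hint : Integrable fun t : ℝ => (m ^ 2)⁻¹ * (t ^ 2 + m ^ 2)⁻¹ :=
    (integrable_inv_sq_add_sq hm.ne').const_mul _
  have hle : ∀ t : ℝ,
      ‖(t ^ 2 + m ^ 2)⁻¹ ^ 2‖ₑ ≤ ENNReal.ofReal ((m ^ 2)⁻¹ * (t ^ 2 + m ^ 2)⁻¹) := by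
    intro t
    have hpos : 0 < t ^ 2 + m ^ 2 := by positivity
    rw [Real.enorm_eq_ofReal (by positivity)]
    refine ENNReal.ofReal_le_ofReal ?_
    rw [sq]
    exact mul_le_mul_of_nonneg_right (inv_anti₀ hm2 (by nlinarith [sq_nonneg t]))
      (inv_nonneg.mpr hpos.le)
  calc ∫⁻ t : ℝ, ‖(t ^ 2 + m ^ 2)⁻¹ ^ 2‖ₑ
      ≤ ∫⁻ t : ℝ, ENNReal.ofReal ((m ^ 2)⁻¹ * (t ^ 2 + m ^ 2)⁻¹) := lintegral_mono hle
    _ = ENNReal.ofReal (∫ t : ℝ, (m ^ 2)⁻¹ * (t ^ 2 + m ^ 2)⁻¹) :=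
        (ofReal_integral_eq_lintegral_ofReal hint
          (Eventually.of_forall fun t => by positivity)).symm
    _ = ENNReal.ofReal (π / m ^ 3) := by
        rw [integral_const_mul, integral_inv_sq_add_sq hm]
        congr 1
        field_simp

/-! ## §2 Tonelli on `ℝ × ℝ³`: the convergent side `α < 2` -/

/-- **Convergent side, product form.** For `α < 2` the transported dial bubble
`(t, 𝐤) ↦ ((t² + (‖𝐤‖²)^{α/2})⁻¹)²` is integrable on `ℝ × B³(0,1)`: by Tonelli, the frequency
integral is `≤ π‖𝐤‖^{-3α/2}` (`lintegral_inv_sq_add_sq_sq_le` with `m = ‖𝐤‖^{α/2}`), which is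
integrable on the unit ball of `ℝ³` because `3α/2 < 3`. [cite: DupuisRancon2011, §2.2] -/
theorem integrable_dialBubble_prod {α : ℝ} (h2 : α < 2) :
    Integrable (fun p : ℝ × EuclideanSpace ℝ (Fin 3) => (p.1 ^ 2 + (‖p.2‖ ^ 2) ^ (α / 2))⁻¹ ^ 2)
      ((volume : Measure ℝ).prod
        ((volume : Measure (EuclideanSpace ℝ (Fin 3))).restrict (ball 0 1))) := by
  have hGm : Measurable
      (fun p : ℝ × EuclideanSpace ℝ (Fin 3) => (p.1 ^ 2 + (‖p.2‖ ^ 2) ^ (α / 2))⁻¹ ^ 2) :=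
    (((measurable_fst.pow_const 2).add
      ((measurable_snd.norm.pow_const 2).pow_const (α / 2))).inv).pow_const 2
  set G : ℝ × EuclideanSpace ℝ (Fin 3) → ℝ :=
    fun p => (p.1 ^ 2 + (‖p.2‖ ^ 2) ^ (α / 2))⁻¹ ^ 2 with hG
  refine ⟨hGm.aestronglyMeasurable, ?_⟩
  show ∫⁻ p, ‖G p‖ₑ ∂((volume : Measure ℝ).prod
      ((volume : Measure (EuclideanSpace ℝ (Fin 3))).restrict (ball 0 1))) < ∞
  rw [lintegral_prod_symm _ hGm.enorm.aemeasurable]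
  -- the origin of `ℝ³` is a null set; off it the frequency integral is finite
  have h0 : ∀ᵐ y ∂((volume : Measure (EuclideanSpace ℝ (Fin 3))).restrict (ball 0 1)), y ≠ 0 := by
    refine ae_restrict_of_ae ?_
    rw [ae_iff]
    simp only [ne_eq, not_not, setOf_eq_eq_singleton, measure_singleton]
  have hbound : ∀ᵐ y ∂((volume : Measure (EuclideanSpace ℝ (Fin 3))).restrict (ball 0 1)),
      ∫⁻ t, ‖G (t, y)‖ₑ ≤ ENNReal.ofReal (π * ‖y‖ ^ (-(3 * α / 2))) := by
    filter_upwards [h0] with y hy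
    have hr : 0 < ‖y‖ := norm_pos_iff.mpr hy
    set m : ℝ := ‖y‖ ^ (α / 2) with hm_def
    have hm : 0 < m := Real.rpow_pos_of_pos hr _
    have hm2 : (‖y‖ ^ 2) ^ (α / 2) = m ^ 2 := by
      rw [hm_def, ← Real.rpow_natCast ‖y‖ 2, ← Real.rpow_mul hr.le,
        ← Real.rpow_natCast (‖y‖ ^ (α / 2)) 2, ← Real.rpow_mul hr.le]
      congr 1
      push_cast
      ring
    have hm3 : π / m ^ 3 = π * ‖y‖ ^ (-(3 * α / 2)) := by
      rw [hm_def, ← Real.rpow_natCast (‖y‖ ^ (α / 2)) 3, ← Real.rpow_mul hr.le,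
        Real.rpow_neg hr.le, div_eq_mul_inv]
      congr 3
      push_cast
      ring
    have hGy : ∀ t : ℝ, G (t, y) = (t ^ 2 + m ^ 2)⁻¹ ^ 2 := by
      intro t
      simp only [hG, hm2]
    simp_rw [hGy]
    rw [← hm3]
    exact lintegral_inv_sq_add_sq_sq_le hm
  calc ∫⁻ y, (∫⁻ t, ‖G (t, y)‖ₑ) ∂((volume : Measure (EuclideanSpace ℝ (Fin 3))).restrict (ball 0 1))
      ≤ ∫⁻ y, ENNReal.ofReal (π * ‖y‖ ^ (-(3 * α / 2)))
          ∂((volume : Measure (EuclideanSpace ℝ (Fin 3))).restrict (ball 0 1)) :=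
        lintegral_mono_ae hbound
    _ < ∞ := by
        refine Integrable.lintegral_lt_top ?_
        refine integrableOn_ball_of_norm_le_rpow (μ := volume) (C := π) (α := 3 * α / 2)
          ?_ ?_ (Eventually.of_forall fun y => ?_) ?_
        · rw [finrank_euclideanSpace_fin]
          norm_num
        · rw [finrank_euclideanSpace_fin]
          push_cast
          linarith
        · rw [Real.norm_of_nonneg (by positivity)]
        · exact ((continuous_norm.measurable.pow_const _).const_mul _).aestronglyMeasurable

/-- **Convergent side.** For `α < 2` the dial bubble `((k₀² + (|𝐤|²)^{α/2})⁻¹)²` is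
integrable on the unit ball of `ℝ^{1+3}`: transport along the volume-preserving splitting
`ℝ^{1+3} ≃ᵐ ℝ × ℝ³`, `k ↦ (k₀, 𝐤)`, under which the unit ball lies in `ℝ × B³(0,1)`, and apply
`integrable_dialBubble_prod`. [cite: DupuisRancon2011, §2.2] -/
theorem integrableOn_dialBubble_of_lt_two {α : ℝ} (h2 : α < 2) :
    IntegrableOn (fun k : FreqMomentum 3 => ((k 0) ^ 2 + (spatialSq k) ^ (α / 2))⁻¹ ^ 2)
      (ball (0 : FreqMomentum 3) 1) := by
  -- the splitting `k ↦ (k₀, 𝐤)`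
  set e : FreqMomentum 3 ≃ᵐ ℝ × EuclideanSpace ℝ (Fin 3) :=
    ((MeasurableEquiv.toLp 2 (Fin 4 → ℝ)).symm.trans
      (MeasurableEquiv.piFinSuccAbove (fun _ : Fin 4 => ℝ) 0)).trans
        (MeasurableEquiv.prodCongr (MeasurableEquiv.refl ℝ)
          (MeasurableEquiv.toLp 2 (Fin 3 → ℝ))) with he_def
  have h3 : MeasurePreserving
      (MeasurableEquiv.prodCongr (MeasurableEquiv.refl ℝ) (MeasurableEquiv.toLp 2 (Fin 3 → ℝ)))
      (volume : Measure (ℝ × (Fin 3 → ℝ))) (volume : Measure (ℝ × EuclideanSpace ℝ (Fin 3))) :=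
    (MeasurePreserving.id (volume : Measure ℝ)).prod (PiLp.volume_preserving_toLp (Fin 3))
  have he : MeasurePreserving e volume volume :=
    ((EuclideanSpace.volume_preserving_symm_measurableEquiv_toLp (Fin 4)).trans
      (volume_preserving_piFinSuccAbove (fun _ : Fin 4 => ℝ) 0)).trans h3
  have he1 : ∀ k : FreqMomentum 3, (e k).1 = k 0 := fun k => rfl
  have he2 : ∀ (k : FreqMomentum 3) (j : Fin 3), (e k).2 j = k j.succ := fun k j => rfl
  have hnorm : ∀ k : FreqMomentum 3, ‖(e k).2‖ ^ 2 = spatialSq k := by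
    intro k
    rw [EuclideanSpace.real_norm_sq_eq]
    simp only [he2, spatialSq]
  -- the integrand is the transported product integrand
  have hFG : (fun k : FreqMomentum 3 => ((k 0) ^ 2 + (spatialSq k) ^ (α / 2))⁻¹ ^ 2) =
      (fun p : ℝ × EuclideanSpace ℝ (Fin 3) => (p.1 ^ 2 + (‖p.2‖ ^ 2) ^ (α / 2))⁻¹ ^ 2) ∘ e := by
    funext k
    simp only [Function.comp_apply]
    rw [he1, hnorm]
  -- the unit ball of `ℝ^{1+3}` lies in `ℝ × B³(0,1)`
  have hsub : ball (0 : FreqMomentum 3) 1 ⊆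
      e ⁻¹' ((univ : Set ℝ) ×ˢ ball (0 : EuclideanSpace ℝ (Fin 3)) 1) := by
    intro k hk
    rw [mem_ball_zero_iff] at hk
    simp only [mem_preimage, mem_prod, mem_univ, true_and, mem_ball_zero_iff]
    have h1 : ‖(e k).2‖ ^ 2 ≤ ‖k‖ ^ 2 := by
      rw [hnorm, norm_sq_eq_sq_add_spatialSq]
      linarith [sq_nonneg (k 0)]
    have h2 : ‖(e k).2‖ ≤ ‖k‖ :=
      (pow_le_pow_iff_left₀ (norm_nonneg _) (norm_nonneg _) two_ne_zero).1 h1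
    exact h2.trans_lt hk
  -- integrability on the product set
  have hG : IntegrableOn
      (fun p : ℝ × EuclideanSpace ℝ (Fin 3) => (p.1 ^ 2 + (‖p.2‖ ^ 2) ^ (α / 2))⁻¹ ^ 2)
      ((univ : Set ℝ) ×ˢ ball (0 : EuclideanSpace ℝ (Fin 3)) 1)
      (volume : Measure (ℝ × EuclideanSpace ℝ (Fin 3))) := by
    rw [IntegrableOn, Measure.volume_eq_prod, ← Measure.prod_restrict, Measure.restrict_univ]
    exact integrable_dialBubble_prod h2
  have hF := (he.integrableOn_comp_preimage e.measurableEmbedding).2 hG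
  rw [hFG]
  exact hF.mono_set hsub

/-! ## §3 The divergent side `α ≥ 2`: comparison with the phonon bubble -/

/-- **Divergent side, pointwise.** For `α ≥ 2` and `‖k‖ < 1` the dial bubble dominates the
phonon bubble with unit sound velocity: `‖k‖⁻⁴ = G_1(k)² ≤ ((k₀² + (|𝐤|²)^{α/2})⁻¹)²`, because
`0 ≤ |𝐤|² ≤ 1` gives `(|𝐤|²)^{α/2} ≤ |𝐤|²`. [folklore] -/
theorem bubbleIntegrand_one_le {α : ℝ} (h2 : 2 ≤ α) (k : FreqMomentum 3) (hk : ‖k‖ < 1) :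
    bubbleIntegrand 1 k ≤ ((k 0) ^ 2 + (spatialSq k) ^ (α / 2))⁻¹ ^ 2 := by
  rw [bubbleIntegrand, phononPropagator, phononForm_one]
  have hs0 : 0 ≤ spatialSq k := spatialSq_nonneg k
  have hsq : ‖k‖ ^ 2 = k 0 ^ 2 + spatialSq k := norm_sq_eq_sq_add_spatialSq k
  by_cases hk0 : k = 0
  · subst hk0
    rw [norm_zero]
    norm_num
    positivity
  · have hkpos : 0 < ‖k‖ := norm_pos_iff.mpr hk0
    have hk1 : ‖k‖ ^ 2 < 1 := by nlinarith
    have hs1 : spatialSq k ≤ 1 := by nlinarith [sq_nonneg (k 0)]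
    have hpow : spatialSq k ^ (α / 2) ≤ spatialSq k := by
      calc spatialSq k ^ (α / 2) ≤ spatialSq k ^ (1 : ℝ) :=
            Real.rpow_le_rpow_of_exponent_ge' hs0 hs1 zero_le_one (by linarith)
        _ = spatialSq k := Real.rpow_one _
    have hA : 0 < k 0 ^ 2 + spatialSq k ^ (α / 2) := by
      rcases (sq_nonneg (k 0)).eq_or_lt with h0 | h0
      · have hs : 0 < spatialSq k := by nlinarith
        have := Real.rpow_pos_of_pos hs (α / 2)
        linarith [sq_nonneg (k 0)]
      · have := Real.rpow_nonneg hs0 (α / 2)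
        linarith
    have hAB : k 0 ^ 2 + spatialSq k ^ (α / 2) ≤ ‖k‖ ^ 2 := by
      rw [hsq]
      linarith
    exact pow_le_pow_left₀ (inv_nonneg.mpr (by positivity)) (inv_anti₀ hA hAB) 2

/-- **Divergent side.** For `α ≥ 2` the dial bubble is not integrable on the unit ball of
`ℝ^{1+3}`: it dominates `bubbleIntegrand 1 = ‖k‖⁻⁴`, whose non-integrability in `d = 3` is the
catalogued Gavoret–Nozières logarithm (`not_integrableOn_bubbleIntegrand`).
[cite: DupuisRancon2011, §2.2] -/
theorem not_integrableOn_dialBubble_of_two_le {α : ℝ} (h2 : 2 ≤ α) :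
    ¬ IntegrableOn (fun k : FreqMomentum 3 => ((k 0) ^ 2 + (spatialSq k) ^ (α / 2))⁻¹ ^ 2)
      (ball (0 : FreqMomentum 3) 1) := by
  intro h
  refine not_integrableOn_bubbleIntegrand (d := 3) le_rfl one_ne_zero one_pos (Λ := 1) ?_
  refine h.mono' (measurable_bubbleIntegrand 1).aestronglyMeasurable ?_
  refine ae_restrict_of_forall_mem measurableSet_ball fun k hk => ?_
  rw [Real.norm_of_nonneg (bubbleIntegrand_nonneg 1 k)]
  exact bubbleIntegrand_one_le h2 k (mem_ball_zero_iff.mp hk)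

end DialPowerCounting

/-! ## §4 The item -/

open DialPowerCounting in
/-- **Item `DialPowerCounting` (stmt-AtomisticToContinuum-14560).** For every `α > 0`, the
one-loop bubble of two dial propagators `((k₀² + (|𝐤|²)^{α/2})⁻¹)²` is integrable on the unit
infrared ball of `ℝ^{1+3}` iff `α < 2`: `α = 2` (and beyond) is the catalogued `d = 3`
logarithm, `α < 2` the infrared-convergent side (`∫₀¹ q^{2-3α/2} dq < ∞`).
[cite: DupuisRancon2011, §2.2] -/
theorem dialPowerCounting_proof :
    Summit.AtomisticToContinuum.BoseEinsteinCondensation.Theses.BECDispersionLadder.DialPowerCounting := by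
  intro α _
  constructor
  · intro h
    by_contra h2
    exact not_integrableOn_dialBubble_of_two_le (not_lt.mp h2) h
  · exact integrableOn_dialBubble_of_lt_two

end Summit.AtomisticToContinuum.BoseEinsteinCondensation.Theorems

end
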